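import Summits.QuantumFields.BalabanUV.Beta.VariantCutoffRoadColumns
import Literature.MathematicalPhysics.QuantumFieldTheory.Balaban1983to89.Beta.RemainderWitness

/-!
# Beta / VariantCutoffRoadWitness — road P2″: JOINT NON-VACUITY of the binder list of `endpointExistence_of_chainTδ`
# (an explicit inhabitant of every hypothesis, and the END APPLIED to it) — the road-P2″ twin of the row owner's
# `Beta.RemainderWitness` (β sub-cell, unit `b2b-balaban-beta-d4-p2`, generation 2; skeleton v2.0 NODE T, leaf T.3)

HONEST FRAMING (page 1 of everything the β sub-cell writes): discharging `BetaPertH` makes Bałaban's UV stability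
UNCONDITIONAL — a real constructive-QFT result; it is NOT the continuum limit and NOT the Clay problem.  HONEST DEPENDENCY
(cell reorg 2026-08-19, verbatim): «continuum YM on T⁴ ⇐ BetaPertH ∧ nine spine estimates (0/9 proved); BetaPertH ⇐ (D1) ∧
(D4) ∧ CAP+tail; G-an2-4 gates asym, D1 and NE2/3/4.»  THIS MODULE DISCHARGES NOTHING of `BetaPertH` and asserts NOTHING
about Bałaban's objects: it is a kernel CERTIFICATE OF CONSISTENCY of the road-P2″ END
`VariantCutoffRoad.endpointExistence_of_chainTδ` — its hypothesis structure `ChainTδ` (the owner's torus leaf list at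
the SUBSTITUTED constants `withEps c (δ(g_k))`, per scale and history), `Hyps` (the ε₁-free conditions, R22, signs,
box, Kotecký–Preiss smallness at δ(γ)), the [I]-side signs, the drift, continuity and forward generation are INHABITED
SIMULTANEOUSLY by closed terms (the owner's zero-activity torus step `RemainderWitness.zeroStep` read at the substituted
record, the owner's numeric witness `RemainderWitness.c₀`, a box `]0,γ₁]` produced by `exists_gamma_hyps`, the CONSTANT
β-family and the lead's canonical construction `FlowStepRuns.modelOf`), and the END is APPLIED to them BY NAME
(`wallEndδ_applied`).  Were the binders jointly unsatisfiable the END would be vacuous; they are not.  As in the owner's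
witness, NOTHING of the analytic CONTENT of any field is tested (zero activities make every estimate `0 ≤ RHS`).
Nothing is cited as a fact (ABSOLUTE RULE).
-/

namespace Summit.QuantumFields.BalabanUV.Beta.VariantCutoffRoadWitness

open Literature.MathematicalPhysics.QuantumFieldTheory.Balaban1983to89
open FlowStep DagBinding FlowStepRuns
open Literature.MathematicalPhysics.QuantumFieldTheory.Balaban1983to89.B12Decay510 (mixedDeriv)
open Literature.MathematicalPhysics.QuantumFieldTheory.Balaban1983to89.Beta.RemainderChain (RemainderConst remActivity)
open Literature.MathematicalPhysics.QuantumFieldTheory.Balaban1983to89.Beta.RemainderChainTorus (PolLeavesT)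
open Literature.MathematicalPhysics.QuantumFieldTheory.Balaban1983to89.Beta.RemainderChainLattice (CondsL remCoeffL)
open Literature.MathematicalPhysics.QuantumFieldTheory.Balaban1983to89.Beta.Drift (OneLoopDrift)
open Literature.MathematicalPhysics.QuantumFieldTheory.Balaban1983to89.Beta.RemainderWitness
  (c₀ c₀_condsL c₀_R22gen c₀_C3act zeroStep zeroStep_spRestr zeroStep_repr213 zeroStep_bound238With mixedDeriv_zero
    splitConst secondMoment_zero)
open Summit.QuantumFields.BalabanUV.Beta.VariantCutoffRoad
open Summit.QuantumFields.BalabanUV.Beta.VariantCutoffRoadColumns (exists_gamma_hyps)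
open Metric Filter Topology Set

noncomputable section

variable {d : ℕ}

/-! ## §1 The zero-activity torus leaf list READ AT A SUBSTITUTED RECORD -/

/-- **THE ZERO LEAVES AT THE RECORD `withEps c ε`**: the owner's zero-activity torus step on the exhausting tori
N_n = n + 1 inhabits `PolLeavesT d M 0 (withEps c ε) ℓ α₂ B₃` for ANY ε with `0 ≤ C₃·ε` and any `B₃ ≥ 0` — the owner's
`zeroLeaves` with its Lemma-3 field read at the substituted smallness (`zeroStep_bound238With` at `withEps c ε`). -/
def zeroLeavesδ (d M : ℕ) [NeZero M] (c : B13.Consts) (ℓ α₂ B₃ ε : ℝ) (hA : 0 ≤ c.C3act * ε) (hB : 0 ≤ B₃) :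
    PolLeavesT d M (fun _ => 0) (withEps c ε) ℓ α₂ B₃ where
  N := fun n => n + 1
  hNlim := tendsto_add_atTop_nat 1
  W := fun n => zeroStep d (n + 1)
  hsp := fun n => zeroStep_spRestr d (n + 1)
  hrep := fun n => zeroStep_repr213 d (n + 1)
  h238 := fun n => zeroStep_bound238With d (n + 1) (withEps c ε) ℓ (by rw [C3act_withEps, withEps_eps1]; exact hA)
  Wn := fun _ => ℂ
  EXn := fun _ _ _ => 0
  emb := fun _ _ _ => ()
  hemb := fun _ _ _ _ => Set.mem_univ _
  hcomp := fun _ _ _ => rfl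
  hn := fun _ _ _ => 0
  E2n := fun _ _ _ _ => 0
  han := fun _ _ => analyticOnNhd_const
  hrepr := fun _ _ _ _ => by rw [mixedDeriv_zero]; simp
  hh := fun _ _ _ => by rw [norm_zero]; positivity
  hlim := fun _ => by simp

/-- **THE ZERO ROAD-P2″ CHAIN** on a box `]0,γ]` with `γ ≤ 1`: the constant split `β ≡ β⁰ ≡ λ`, `β¹ ≡ 0` (the owner's
`splitConst`), zero kernels, and at each scale/history the zero leaves at the record `withEps c (δ(g_k))`
(`0 ≤ C₃·δ(g_k)` from `C₃ ≥ 0`, `A₁ ≥ 0`, `0 < g_k ≤ γ ≤ 1`). -/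
def zeroChainδ (d M : ℕ) [NeZero M] (μ ν : Fin d) (lam γ : ℝ) (c : B13.Consts) (ℓ α₂ B₃ A₁ : ℝ) (p₀ : ℕ)
    (hγ1 : γ ≤ 1) (hC3 : 0 ≤ c.C3act) (hA₁ : 0 ≤ A₁) (hB : 0 ≤ B₃) :
    ChainTδ d M μ ν (splitConst lam) γ c ℓ α₂ B₃ A₁ p₀ where
  P1 := fun _ _ => fun _ _ _ => 0
  beta1_eq := fun _ _ _ => by
    show (0 : ℝ) = B12Beta.secondMoment (fun _ _ (_ : Fin d → ℤ) => (0 : ℝ)) μ ν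
    rw [secondMoment_zero]
  leaves := fun k p hp => zeroLeavesδ d M c ℓ α₂ B₃ (deltaOf A₁ p₀ (p (Fin.last k)))
    (mul_nonneg hC3 (deltaOf_nonneg hA₁ p₀ (hp (Fin.last k)).1 ((hp (Fin.last k)).2.trans hγ1))) hB

/-! ## §2 Every binder inhabited simultaneously, and the END applied -/

/-- `C₃(c₀) = 162 ≥ 0`. -/
theorem c₀_C3act_nonneg (d : ℕ) : 0 ≤ (c₀ d).C3act := by rw [c₀_C3act]; norm_num

/-- The ε₁-FREE conditions hold for the owner's numeric witness `c₀ d` at ℓ = 2. -/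
theorem c₀_condsL0 (d : ℕ) : CondsL0 d (c₀ d) 2 := CondsL0.of_condsL (c₀_condsL d)

/-- The constant one-loop sequence `β⁰ ≡ λ` has drift `λ` with error 0. -/
theorem drift_const (lam : ℝ) : OneLoopDrift lam 0 (splitConst lam).β0 := by
  intro k
  simp only [splitConst, Finset.sum_const, Finset.card_range, nsmul_eq_mul]
  rw [show (k : ℝ) * lam - lam * k = 0 by ring, abs_zero]

/-- **EVERY BINDER OF THE ROAD-P2″ END IS INHABITED SIMULTANEOUSLY** (any d, M ≥ 1, μ, ν, any λ > 0, A₁ := 1, any p₀):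
there is a box `]0,γ₁]`, `γ₁ ≤ 1`, carrying a road-P2″ chain (the zero chain at the substituted records), the
hypotheses `Hyps d γ₁ (c₀ d) 2 1 p₀`, the [I]-side signs at α₂ = B₃ = 1, δ₀(c₀) = 1, the drift (b := λ, A := 0),
continuity and forward generation of `modelOf (β ≡ λ)` — AND the threshold `δ(γ₁)·K_rem,L < λ`. -/
theorem binders_inhabited (d M : ℕ) [NeZero M] (μ ν : Fin d) {lam : ℝ} (hlam : 0 < lam) (p₀ : ℕ) :
    ∃ γ₁ : ℝ, 0 < γ₁ ∧ γ₁ ≤ 1 ∧ Nonempty (ChainTδ d M μ ν (splitConst lam) γ₁ (c₀ d) 2 1 1 1 p₀) ∧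
      Hyps d γ₁ (c₀ d) 2 1 p₀ ∧ OneLoopDrift lam 0 (splitConst lam).β0 ∧ BetaContH γ₁ (fun _ _ => lam) ∧
      ForwardGenerated (modelOf fun _ _ => lam) (fun _ _ => lam) ∧
      deltaOf 1 p₀ γ₁ * remCoeffL d M (c₀ d) 1 1 < lam := by
  obtain ⟨γ₁, hγ₁, hγ₁1, H, hlt⟩ :=
    exists_gamma_hyps (c₀_condsL0 d) (c₀_R22gen d) (c₀_C3act_nonneg d) zero_le_one M 1 1 hlam one_pos
  exact ⟨γ₁, hγ₁, hγ₁1, ⟨zeroChainδ d M μ ν lam γ₁ (c₀ d) 2 1 1 1 p₀ hγ₁1 (c₀_C3act_nonneg d) zero_le_one zero_le_one⟩,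
    H, drift_const lam, fun _ => continuousOn_const, modelOf_forwardGenerated _, hlt⟩

/-- **THE ROAD-P2″ ω-FORM END, APPLIED**: `ChainTδ.abs_beta1_le` at the zero chain on such a box — conclusion
`RemainderMod (splitConst λ) γ₁ (δ(·)·K_rem,L)` obtained BY NAME (d ≥ 1). -/
theorem absBeta1δ_applied (d M : ℕ) [NeZero M] (hd : 0 < d) (μ ν : Fin d) {lam : ℝ} (hlam : 0 < lam) (p₀ : ℕ) :
    ∃ γ₁ : ℝ, 0 < γ₁ ∧ RoadP2Chain.RemainderMod (splitConst lam) γ₁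
      (fun g => deltaOf 1 p₀ g * remCoeffL d M (c₀ d) 1 1) := by
  obtain ⟨γ₁, hγ₁, hγ₁1, H, _⟩ :=
    exists_gamma_hyps (c₀_condsL0 d) (c₀_R22gen d) (c₀_C3act_nonneg d) zero_le_one M 1 1 hlam one_pos
  exact ⟨γ₁, hγ₁, (zeroChainδ d M μ ν lam γ₁ (c₀ d) 2 1 1 1 p₀ hγ₁1 (c₀_C3act_nonneg d) zero_le_one
    zero_le_one).abs_beta1_le H one_pos zero_le_one (by show (0 : ℝ) < 1; norm_num) hd⟩

/-- **THE ROAD-P2″ WALL END, APPLIED**: `endpointExistence_of_chainTδ` with EVERY argument a closed term — conclusion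
`EndpointExistence (modelOf (β ≡ λ))` for every λ > 0 (d ≥ 1, any M ≥ 1, μ, ν, p₀).  Zero content about Bałaban's
flow; the content is that the END's ARGUMENTS exist together. -/
theorem wallEndδ_applied (d M : ℕ) [NeZero M] (hd : 0 < d) (μ ν : Fin d) {lam : ℝ} (hlam : 0 < lam) (p₀ : ℕ) :
    EndpointExistence (modelOf fun _ _ => lam) := by
  obtain ⟨γ₁, hγ₁, hγ₁1, H, _⟩ :=
    exists_gamma_hyps (c₀_condsL0 d) (c₀_R22gen d) (c₀_C3act_nonneg d) zero_le_one M 1 1 hlam one_pos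
  exact endpointExistence_of_chainTδ (modelOf_forwardGenerated _) (splitConst lam)
    (zeroChainδ d M μ ν lam γ₁ (c₀ d) 2 1 1 1 p₀ hγ₁1 (c₀_C3act_nonneg d) zero_le_one zero_le_one) H one_pos
    zero_le_one (by show (0 : ℝ) < 1; norm_num) hd hγ₁ hlam (drift_const lam) fun _ => continuousOn_const

/-- d = 4, M = 3, λ = 1, p₀ = 23 (SMALLNESS §4.3's witness exponent): the road-P2″ END applies at the physical dimension. -/
example : EndpointExistence (modelOf fun _ _ => (1 : ℝ)) :=
  wallEndδ_applied 4 3 (by norm_num) 0 1 one_pos 23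

end

end Summit.QuantumFields.BalabanUV.Beta.VariantCutoffRoadWitness
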